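import Summits.Schanuel.Schanuel.Theorems.ZilberEacIrrationalPhaseBranch
import Summits.Schanuel.Schanuel.Theorems.ZilberEacHyperellipticConstFibreSummary
import Literature.NumberTheory.Transcendental.LindemannWeierstrassProofs
import HarnessLib

/-!
# Arbitrary base branches, LXXVI: the RESIDUE CLASS has an IRRATIONAL top phase (Lindemann: `π`
# is transcendental) — constant fibres over EVERY cyclic cover `x₁^k = P(x₀)`, with no circle and
# no residue condition

HONEST FRAMING.  Cell `pub-schanuel` (Zilber's Exponential-Algebraic Closedness, case ladder;
host summit Schanuel), seat 2, gen 32.  Files XIX–XXIII, XXX, XXXIV, XLIV, XLV decided the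
constant-fibre cylinders `{x₁^k = P(x₀), y₀ = θ}` (`P` monic of degree `M` with a simple root)
except in ONE configuration: `k = 2`, `M ≡ 2 (mod 4)`, `M ≥ 6`, `θ` ON the circle
`M·log|θ| + Re p_{M−1} = 0` — the RESIDUE CLASS (`k ∣ 2M`, `e = 2M/k ≡ 2 (mod 4)`: the top phase
`Π_M = z^M`, `z^k = 2πi`, is purely imaginary, `(z^M)² = (2πi)^e = −(2π)^e`) with the subleading
(τ-carrying) coefficient killed too.  File LXXII (the growth/Kronecker dichotomy) needs neither:
only that `Im Π_M/2π = ±(2π)^{e/2 − 1}` be IRRATIONAL — and for `e ≠ 2` it is, because `π` is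
transcendental (Lindemann 1882; in the tree: `Literature.…transcendental_pi_holds`).  So:
* **`irrational_ratCast_mul_pi_pow`** — `q·π^n ∉ ℚ` (`q ∈ ℚˣ`, `n ≥ 1`);
* **`irrational_im_div_two_pi_of_sq_eq`** — `w² = (2πi)^e`, `e ≡ 2 (mod 4)`, `e ≠ 2` ⟹
  `Im w/2π ∉ ℚ`;
* **`unprojectedDense_branch_of_residue_ne`** / **`unprojectedDense_branch_unitFibre_of_ne`** — a
  cylinder germ `(s^{-k}, Φ(s)s^{-M}, ψ(s), e^{x₁})` with `Φ(0) = 1`, `ψ(0) ≠ 0` and `M ≠ k` is dense: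
  off the residue class by growth (file XX), in it by Kronecker (file LXXII) — NO condition left
  except `M ≠ k` (`e = 2`: `Π_M = ±2πi·(unit)`, genuinely resonant: the conics `x₁² = P`, `deg P = 2`,
  were done by transcendence in file XLIV; `k = M ≥ 3` by the other sheets, file XXXIV);
* **`unprojectedDensityQuestion_cyclicCover_constFibre_all`** — for EVERY `k ≥ 2`, EVERY monic `P`
  of degree `M ≥ 1` with a simple root and EVERY `θ ≠ 0`: `{x₁^k − P(x₀) = 0, y₀ = θ}` is in
  Mantova–Masser's case AND has Zariski-dense exponential points.  The circle of file XXX is gone.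
Decided instances of an OPEN question (Mantova–Masser, PLMS 2024 §1 p. 5); EC(3,2) OPEN; NOT
Schanuel's conjecture (neither used nor implied; Lindemann's theorem is used, unconditionally);
EAC ⇏ SC.
-/

noncomputable section

open Filter Topology Set Complex MvPolynomial
open Literature.NumberTheory.Transcendental Literature.ModelTheory.Zilber
open Literature.ModelTheory.ExponentialFields

set_option linter.dupNamespace false

namespace Summit.Schanuel.Schanuel.Theorems

/-! ## Part A. Lindemann: rational multiples of powers of `π` are irrational -/

/-- **`q·π^n` is irrational** for `q ∈ ℚ`, `q ≠ 0`, `n ≥ 1` (`π` is transcendental — Lindemann).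
[cite: Lindemann1882] -/
theorem irrational_ratCast_mul_pi_pow {q : ℚ} (hq : q ≠ 0) {n : ℕ} (hn : n ≠ 0) :
    Irrational ((q : ℝ) * Real.pi ^ n) := by
  rintro ⟨r, hr⟩
  have hπ : Transcendental ℚ Real.pi := Literature.NumberTheory.Transcendental.transcendental_pi_holds
  have hpow : Transcendental ℚ (Real.pi ^ n) := hπ.pow (Nat.pos_of_ne_zero hn)
  apply hpow
  have hqR : (q : ℝ) ≠ 0 := by exact_mod_cast hq
  have e : Real.pi ^ n = ((r / q : ℚ) : ℝ) := by
    rw [Rat.cast_div, eq_div_iff hqR]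
    linear_combination -hr
  rw [e]
  exact ⟨Polynomial.X - Polynomial.C (r / q), Polynomial.X_sub_C_ne_zero _, by simp⟩

/-- **Square roots of `(2πi)^e`, `e ≡ 2 (mod 4)`, `e ≠ 2`, have `Im w/2π` irrational**:
`w = ±(2π)^{e/2}i`, `Im w/2π = ±(2π)^{e/2−1} = ±4^j π^{2j}` (`e = 4j + 2`, `j ≥ 1`). [folklore +
Lindemann] -/
theorem irrational_im_div_two_pi_of_sq_eq {w : ℂ} {e : ℕ} (hw : w ^ 2 = (2 * Real.pi * I) ^ e)
    (he : e % 4 = 2) (he2 : e ≠ 2) : Irrational (w.im / (2 * Real.pi)) := by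
  obtain ⟨j, rfl⟩ : ∃ j, e = 4 * j + 2 := ⟨e / 4, by omega⟩
  have hj : j ≠ 0 := by
    rintro rfl
    exact he2 rfl
  set c : ℝ := (2 * Real.pi) ^ (2 * j + 1) with hc
  have hπ : 0 < Real.pi := Real.pi_pos
  have hIe : I ^ (4 * j + 2) = -1 := by
    rw [pow_add, pow_mul, Complex.I_pow_four, one_pow, one_mul, Complex.I_sq]
  have hw2 : w ^ 2 = -((c : ℂ)) ^ 2 := by
    rw [hw, mul_pow, hIe, hc]
    push_cast
    ring
  have hfact : (w - c * I) * (w + c * I) = 0 := by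
    have e1 : (w - c * I) * (w + c * I) = w ^ 2 - (c : ℂ) ^ 2 * I ^ 2 := by ring
    rw [e1, Complex.I_sq, hw2]
    ring
  have hirr : Irrational (c / (2 * Real.pi)) := by
    have e1 : c / (2 * Real.pi) = (((4 : ℚ) ^ j : ℚ) : ℝ) * Real.pi ^ (2 * j) := by
      rw [hc, pow_succ, mul_div_assoc, div_self (by positivity), mul_one, mul_pow, pow_mul]
      push_cast
      norm_num
    rw [e1]
    exact irrational_ratCast_mul_pi_pow (pow_ne_zero _ (by norm_num)) (by omega)
  rcases mul_eq_zero.1 hfact with h | h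
  · have hw' : w = c * I := by linear_combination h
    have him : w.im = c := by rw [hw']; simp
    rw [him]
    exact hirr
  · have hw' : w = -(c * I) := by linear_combination h
    have him : w.im = -c := by rw [hw']; simp
    rw [him, neg_div]
    exact hirr.neg

/-! ## Part B. Germs: the residue class with `M ≠ k` -/

/-- **The residue class has an irrational top phase when `M ≠ k`: dense.**  A cylinder germ
`(s^{-k}, Φ(s)s^{-M}, ψ(s), e^{x₁})` (`k, M ≥ 1`, `M ≠ k`, `ψ(0) ≠ 0`, `Φ(0) = 1`) in an irreducible
closed `S` of dimension `≤ 2`, with `k ∣ 2M` and `2M/k ≡ 2 (mod 4)`: then for any `k`-th root `z`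
of `2πi`, `(z^M)² = (2πi)^{2M/k}` and `Im(z^M)/2π` is irrational (Part A), so file LXXII applies.
[cite: MantovaMasser2023, §1 Further remarks, p. 5 (the question, open in general)] (new) -/
theorem unprojectedDense_branch_of_residue_ne {S : Set (Fin 2 ⊕ Fin 2 → ℂ)}
    (hS : IsIrreducibleClosed ℂ S) (hdim : zariskiDim ℂ S ≤ (2 : ℕ))
    {k M : ℕ} (hk : 1 ≤ k) (hM : 1 ≤ M) (hMk : M ≠ k) {ψ : ℂ → ℂ} (hψ : AnalyticAt ℂ ψ 0)
    {θ : ℂ} (hθ0 : θ ≠ 0) (hψ0 : ψ 0 = θ) {Φ : ℂ → ℂ} (hΦ : AnalyticAt ℂ Φ 0) (hΦ0 : Φ 0 = 1)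
    (hres : k ∣ 2 * M ∧ (2 * M / k) % 4 = 2)
    (hgerm : ∀ᶠ s in 𝓝[≠] (0 : ℂ),
      (Sum.elim ![(s ^ k)⁻¹, Φ s * (s ^ M)⁻¹] ![ψ s, Complex.exp (Φ s * (s ^ M)⁻¹)] :
        Fin 2 ⊕ Fin 2 → ℂ) ∈ S) :
    UnprojectedDense S := by
  obtain ⟨z, hz⟩ := IsAlgClosed.exists_pow_nat_eq (2 * Real.pi * I : ℂ) (by omega : 0 < k)
  obtain ⟨⟨e, he⟩, hmod⟩ := hres
  have hediv : 2 * M / k = e := by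
    rw [he, Nat.mul_div_cancel_left _ (by omega)]
  rw [hediv] at hmod
  have he2 : e ≠ 2 := by
    rintro rfl
    apply hMk
    omega
  have hw : (z ^ M) ^ 2 = (2 * Real.pi * I) ^ e := by
    rw [← pow_mul, show M * 2 = k * e by omega, pow_mul, hz]
  refine unprojectedDense_branch_of_irrational_phase hS hdim hk hM hψ hθ0 hψ0 hΦ ⟨z, hz, ?_⟩ hgerm
  rw [hΦ0, one_mul]
  exact irrational_im_div_two_pi_of_sq_eq hw hmod he2

/-- **Unit fibre values along a place with `Φ(0) = 1` and `M ≠ k`: dense, NO residue condition.**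
Off the residue class a good direction exists (file XX, growth); in it the top phase is irrational
(this file, Kronecker). [cite: MantovaMasser2023, §1 Further remarks, p. 5 (the question, open in
general)] (new) -/
theorem unprojectedDense_branch_unitFibre_of_ne {S : Set (Fin 2 ⊕ Fin 2 → ℂ)}
    (hS : IsIrreducibleClosed ℂ S) (hdim : zariskiDim ℂ S ≤ (2 : ℕ))
    {k M : ℕ} (hk : 1 ≤ k) (hM : 1 ≤ M) (hMk : M ≠ k) {ψ : ℂ → ℂ} (hψ : AnalyticAt ℂ ψ 0)
    {θ : ℂ} (hθ0 : θ ≠ 0) (hψ0 : ψ 0 = θ) {Φ : ℂ → ℂ} (hΦ : AnalyticAt ℂ Φ 0) (hΦ0 : Φ 0 = 1)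
    (hgerm : ∀ᶠ s in 𝓝[≠] (0 : ℂ),
      (Sum.elim ![(s ^ k)⁻¹, Φ s * (s ^ M)⁻¹] ![ψ s, Complex.exp (Φ s * (s ^ M)⁻¹)] :
        Fin 2 ⊕ Fin 2 → ℂ) ∈ S) :
    UnprojectedDense S := by
  by_cases hres : k ∣ 2 * M ∧ (2 * M / k) % 4 = 2
  · exact unprojectedDense_branch_of_residue_ne hS hdim hk hM hMk hψ hθ0 hψ0 hΦ hΦ0 hres hgerm
  · obtain ⟨z, hz, hzre⟩ := exists_direction_powerCurve hk hres (M := M)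
    exact unprojectedDense_branch_growth_of_exists_direction hS hdim hk hM hψ hθ0 hψ0 hΦ
      ⟨z, hz, by rw [hΦ0, one_mul]; exact hzre⟩ hgerm

/-! ## Part C. Constant fibres over the cyclic covers `x₁^k = P(x₀)`: all configurations -/

section CyclicCover

variable (P : Polynomial ℂ)

/-- **Constant fibres over `x₁^k = P(x₀)`, `deg P ≠ k`: dense** (`k ≥ 1`, `P` monic of degree
`M ≥ 1` with a simple root, `θ ≠ 0`) — principal sheet `x₀ = s^{-k}`, `x₁ = Φ(s)s^{-M}`,
`Φ(0) = 1` (file XXXIV's `superelliptic_sheet_facts`), then Part B.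
[cite: MantovaMasser2023, §1 Further remarks, p. 5 (the question, open in general)] (new) -/
theorem unprojectedDense_superelliptic_constFibre_of_ne {k : ℕ} (hk : 1 ≤ k) (hP : P.Monic)
    (hM : 1 ≤ P.natDegree) {r : ℂ} (hr : P.IsRoot r) (hr1 : P.derivative.eval r ≠ 0)
    (hMk : P.natDegree ≠ k) {θ : ℂ} (hθ : θ ≠ 0) :
    UnprojectedDense {w : Fin 2 ⊕ Fin 2 → ℂ |
      MvPolynomial.eval ![w (Sum.inl 0), w (Sum.inl 1)]
          (X 1 ^ k - Polynomial.aeval (X 0 : MvPolynomial (Fin 2) ℂ) P) = 0 ∧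
      w (Sum.inr 0) = MvPolynomial.eval ![w (Sum.inl 0), w (Sum.inl 1)]
        (MvPolynomial.C θ : MvPolynomial (Fin 2) ℂ)} := by
  have hS := isIrreducibleClosed_curveGraphFibre (MvPolynomial.C θ : MvPolynomial (Fin 2) ℂ)
    (irreducible_superellipticMv P hk hr hr1)
  have hdim := zariskiDim_curveGraphFibre (MvPolynomial.C θ : MvPolynomial (Fin 2) ℂ)
    (irreducible_superellipticMv P hk hr hr1)
  obtain ⟨Φ, hΦan, hΦ0, hsheet⟩ := superelliptic_sheet_facts P hk hP (ζ := 1) (one_pow k)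
  refine unprojectedDense_branch_unitFibre_of_ne hS (le_of_eq hdim) hk hM hMk
    (ψ := fun _ => θ) analyticAt_const hθ rfl hΦan hΦ0 ?_
  filter_upwards [hsheet] with s hs
  refine ⟨?_, ?_⟩
  · simp only [Sum.elim_inl, Matrix.cons_val_zero, Matrix.cons_val_one]
    rw [eval_superellipticMv]
    simp only [Matrix.cons_val_zero, Matrix.cons_val_one]
    exact hs
  · simp only [Sum.elim_inr, Matrix.cons_val_zero, MvPolynomial.eval_C]

/-- **Case ∧ dense for `deg P ≠ k`** (`k ≥ 2`). [cite: MantovaMasser2023, §1 Further remarks,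
p. 5 (the question, open in general)] (new) -/
theorem unprojectedDensityQuestion_superelliptic_constFibre_of_ne {k : ℕ} (hk : 2 ≤ k) (hP : P.Monic)
    (hM : 1 ≤ P.natDegree) {r : ℂ} (hr : P.IsRoot r) (hr1 : P.derivative.eval r ≠ 0)
    (hMk : P.natDegree ≠ k) {θ : ℂ} (hθ : θ ≠ 0) :
    MMCaseDimPiOneFree {w : Fin 2 ⊕ Fin 2 → ℂ |
        MvPolynomial.eval ![w (Sum.inl 0), w (Sum.inl 1)]
            (X 1 ^ k - Polynomial.aeval (X 0 : MvPolynomial (Fin 2) ℂ) P) = 0 ∧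
        w (Sum.inr 0) = MvPolynomial.eval ![w (Sum.inl 0), w (Sum.inl 1)]
          (MvPolynomial.C θ : MvPolynomial (Fin 2) ℂ)} ∧
      UnprojectedDense {w : Fin 2 ⊕ Fin 2 → ℂ |
        MvPolynomial.eval ![w (Sum.inl 0), w (Sum.inl 1)]
            (X 1 ^ k - Polynomial.aeval (X 0 : MvPolynomial (Fin 2) ℂ) P) = 0 ∧
        w (Sum.inr 0) = MvPolynomial.eval ![w (Sum.inl 0), w (Sum.inl 1)]
          (MvPolynomial.C θ : MvPolynomial (Fin 2) ℂ)} :=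
  ⟨mmCase_superelliptic_constFibre P hk hr hr1 hθ,
    unprojectedDense_superelliptic_constFibre_of_ne P (by omega) hP hM hr hr1 hMk hθ⟩

/-- **Plain coordinates**, `deg P ≠ k`: `{x₁^k − P(x₀) = 0, y₀ = θ}` is in the case AND dense.
[cite: MantovaMasser2023, §1 Further remarks, p. 5 (the question, open in general)] (new) -/
theorem unprojectedDensityQuestion_superelliptic_constFibre_of_ne' {k : ℕ} (hk : 2 ≤ k)
    (hP : P.Monic) (hM : 1 ≤ P.natDegree) {r : ℂ} (hr : P.IsRoot r)
    (hr1 : P.derivative.eval r ≠ 0) (hMk : P.natDegree ≠ k) {θ : ℂ} (hθ : θ ≠ 0) :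
    MMCaseDimPiOneFree {w : Fin 2 ⊕ Fin 2 → ℂ |
        w (Sum.inl 1) ^ k - P.eval (w (Sum.inl 0)) = 0 ∧ w (Sum.inr 0) = θ} ∧
      UnprojectedDense {w : Fin 2 ⊕ Fin 2 → ℂ |
        w (Sum.inl 1) ^ k - P.eval (w (Sum.inl 0)) = 0 ∧ w (Sum.inr 0) = θ} := by
  have e : {w : Fin 2 ⊕ Fin 2 → ℂ |
        MvPolynomial.eval ![w (Sum.inl 0), w (Sum.inl 1)]
            (X 1 ^ k - Polynomial.aeval (X 0 : MvPolynomial (Fin 2) ℂ) P) = 0 ∧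
        w (Sum.inr 0) = MvPolynomial.eval ![w (Sum.inl 0), w (Sum.inl 1)]
          (MvPolynomial.C θ : MvPolynomial (Fin 2) ℂ)} =
      {w : Fin 2 ⊕ Fin 2 → ℂ |
        w (Sum.inl 1) ^ k - P.eval (w (Sum.inl 0)) = 0 ∧ w (Sum.inr 0) = θ} := by
    ext w
    simp only [Set.mem_setOf_eq, eval_superellipticMv, MvPolynomial.eval_C, Matrix.cons_val_zero,
      Matrix.cons_val_one]
  have h := unprojectedDensityQuestion_superelliptic_constFibre_of_ne P hk hP hM hr hr1 hMk hθ
  rw [e] at h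
  exact h

/-- **CONSTANT FIBRES OVER EVERY CYCLIC COVER — the complete statement.**  For every `k ≥ 2`,
every monic `P` of degree `M ≥ 1` with a simple root and every `θ ≠ 0`, the cylinder
`{x₁^k − P(x₀) = 0, y₀ = θ}` is in Mantova–Masser's case AND has Zariski-dense exponential
points: `M ≠ k` by Part B (growth or Kronecker+Lindemann); `M = k ≥ 3` by the other sheets
(file XXXIV); `M = k = 2` (conics) by transcendence (file XLIV).  Supersedes file XLV's
`unprojectedDensityQuestion_cyclicCover_constFibre` (no configuration hypothesis).
[cite: MantovaMasser2023, §1 Further remarks, p. 5 (the question, open in general)] (new) -/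
theorem unprojectedDensityQuestion_cyclicCover_constFibre_all {k : ℕ} (hk : 2 ≤ k) (hP : P.Monic)
    (hM : 1 ≤ P.natDegree) {r : ℂ} (hr : P.IsRoot r) (hr1 : P.derivative.eval r ≠ 0) {θ : ℂ}
    (hθ : θ ≠ 0) :
    MMCaseDimPiOneFree {w : Fin 2 ⊕ Fin 2 → ℂ |
        w (Sum.inl 1) ^ k - P.eval (w (Sum.inl 0)) = 0 ∧ w (Sum.inr 0) = θ} ∧
      UnprojectedDense {w : Fin 2 ⊕ Fin 2 → ℂ |
        w (Sum.inl 1) ^ k - P.eval (w (Sum.inl 0)) = 0 ∧ w (Sum.inr 0) = θ} := by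
  by_cases hMk : P.natDegree = k
  · by_cases hk3 : 3 ≤ k
    · exact unprojectedDensityQuestion_superelliptic_constFibre_all P hk3 hP hM hr hr1 hθ
    · have hk2 : k = 2 := by omega
      subst hk2
      exact unprojectedDensityQuestion_conic_constFibre P hP hMk hr hr1 hθ
  · exact unprojectedDensityQuestion_superelliptic_constFibre_of_ne' P hk hP hM hr hr1 hMk hθ

/-- **Every hyperelliptic curve, every constant fibre**: `P` monic of degree `M ≥ 1` with a simple
root, `θ ≠ 0` ⟹ `{x₁² − P(x₀) = 0, y₀ = θ}` case ∧ dense (including `M ≡ 2 (mod 4)`, `θ` on the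
circle of file XXX — decided by Lindemann's theorem). [cite: MantovaMasser2023, §1 Further remarks,
p. 5 (the question, open in general)] (new) -/
theorem unprojectedDensityQuestion_hyperelliptic_constFibre_all (hP : P.Monic) (hM : 1 ≤ P.natDegree)
    {r : ℂ} (hr : P.IsRoot r) (hr1 : P.derivative.eval r ≠ 0) {θ : ℂ} (hθ : θ ≠ 0) :
    MMCaseDimPiOneFree {w : Fin 2 ⊕ Fin 2 → ℂ |
        w (Sum.inl 1) ^ 2 - P.eval (w (Sum.inl 0)) = 0 ∧ w (Sum.inr 0) = θ} ∧
      UnprojectedDense {w : Fin 2 ⊕ Fin 2 → ℂ |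
        w (Sum.inl 1) ^ 2 - P.eval (w (Sum.inl 0)) = 0 ∧ w (Sum.inr 0) = θ} :=
  unprojectedDensityQuestion_cyclicCover_constFibre_all P le_rfl hP hM hr hr1 hθ

/-- Example: `{x₁² = x₀⁶ + x₀, y₀ = θ}` (genus 2; `M = 6 ≡ 2 (mod 4)`, the residue class of file
XXX, whose circle was `6·log|θ| = 0`, i.e. `|θ| = 1`): case ∧ dense for EVERY `θ ≠ 0`.
[cite: MantovaMasser2023, §1 Further remarks, p. 5 (the question, open in general)] (new) -/
theorem unprojectedDensityQuestion_genusTwoSextic_constFibre {θ : ℂ} (hθ : θ ≠ 0) :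
    MMCaseDimPiOneFree {w : Fin 2 ⊕ Fin 2 → ℂ |
        w (Sum.inl 1) ^ 2 - (w (Sum.inl 0) ^ 6 + w (Sum.inl 0)) = 0 ∧ w (Sum.inr 0) = θ} ∧
      UnprojectedDense {w : Fin 2 ⊕ Fin 2 → ℂ |
        w (Sum.inl 1) ^ 2 - (w (Sum.inl 0) ^ 6 + w (Sum.inl 0)) = 0 ∧ w (Sum.inr 0) = θ} := by
  have hP : (Polynomial.X ^ 6 + Polynomial.X : Polynomial ℂ).Monic := by
    refine Polynomial.monic_X_pow_add ?_
    exact Polynomial.degree_X_le.trans_lt (by norm_num)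
  have hM : (Polynomial.X ^ 6 + Polynomial.X : Polynomial ℂ).natDegree = 6 := by compute_degree!
  have h := unprojectedDensityQuestion_cyclicCover_constFibre_all (Polynomial.X ^ 6 + Polynomial.X)
    le_rfl hP (by rw [hM]; norm_num) (r := 0) (by simp) (by simp) hθ
  simpa only [Polynomial.eval_add, Polynomial.eval_pow, Polynomial.eval_X] using h

end CyclicCover

end Summit.Schanuel.Schanuel.Theorems

end
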